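import Mathlib
import HarnessLib
import Summits.ValiantsHypothesis.ValiantsHypothesis.Theorems.MonotoneRestorationOrbitRestorationQPDepthThreeRungDefs
import Literature.Computability.AlgebraicComplexity.PatternExpressions
import Literature.Computability.AlgebraicComplexity.DawarWilsenach2025
import Literature.Combinatorics.SimpleGraph.TreeDecomposition

/-!
# Theorems-side vocabulary of line `linear_width` (crux `MonotoneRestorationQP`, stmt-ValiantsHypothesis-15886)

The registered skeleton `Cruxes/MonotoneRestorationQP/Lines/linear_width.lean` (447dbbe2994c48fa) phrases its four stubs
(`stub_linearDegreeWidthRestoration`, `stub_degreeLifting`, `stub_homDeterminedVP`, `stub_orbitCompression`) in a small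
local vocabulary — `patternGraph`, `HomIndist`, `PolylogHomDetermined`, `QPOrbitSymm` and the graded family
`WidthRung d` (plus the PARAMETERLESS abbreviations `PolylogDegreeWidthRestoration = ∀ c, WidthRung fun n => (log₂ n + c)^c`,
`LinearDegreeWidthRestoration = ∀ c, WidthRung fun n => c * (n + 1)`, `WidthRestorationQP`, `HomDeterminedVP`, which are
conjecture-grade statements and are deliberately NOT declared here — exactly the policy of
`…OrbitRestorationQPDepthThreeRungDefs.lean` for line `depth_three_rung`; a steward who wants the line's stubs statable
Theorems-side re-registers them unfolded through `WidthRung`, as was done for `stub_logDepthRestoration`).  Theorems files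
cannot import Cruxes files, so any Theorems-side result stated on this line (a new rung of `WidthRung`, an on-path
certificate, a stub close) needs these declarations on the Theorems side.  This file collects the PARAMETRISED ones VERBATIM
from the skeleton (same short names, same bodies; `IsMatrixSymmetric` is the existing
`OrbitRestorationQPDepthThreeRung.IsMatrixSymmetric`, re-exported, not re-declared).  ROUTE-INDEPENDENT: no `Theses` import.
Proved here: `widthRung_mono` (the family is antitone in the degree budget) and `widthRung_of_top`.

Nothing conjectural is asserted; no instance, no notation; no stub is closed; VP ≠ VNP is not touched.
[cite: DawarPagoSeppelt2025, Def. 6.1, Thm. 6.3; DwivediPagoSeppelt2026, Def. 3.2; DawarWilsenach2025, §3.3]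
-/

set_option linter.dupNamespace false

noncomputable section

namespace Summit.ValiantsHypothesis.ValiantsHypothesis.Theorems.MonotoneRestorationQPLinearWidth

open Literature.Computability.AlgebraicComplexity MvPolynomial

export OrbitRestorationQPDepthThreeRung (IsMatrixSymmetric)

/-! ### The graded family -/

/-- The pattern graph (on `Fin a ⊕ Fin b`) of a bipartite multigraph pattern, as in line
`pattern-width` of crux `OrbitRestorationQP`. [cite: DawarPagoSeppelt2025, §2] -/
def patternGraph {a b : ℕ} (E : Multiset (Fin a × Fin b)) : SimpleGraph (Fin a ⊕ Fin b) :=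
  SimpleGraph.fromRel fun u v => ∃ p ∈ E, u = Sum.inl p.1 ∧ v = Sum.inr p.2

/-- Two points `A, B ∈ ℂ^{n×n}` (edge-weighted `(n,n)`-vertex bipartite graphs) are HOMOMORPHISM
INDISTINGUISHABLE BELOW TREEWIDTH `k`: every homomorphism polynomial of a bipartite multigraph pattern
of treewidth `< k` takes the same value at `A` and at `B` (for simple / edge-weighted graphs this is
`C^k`-equivalence: Dvořák 2010, Dell–Grohe–Rattan 2018). [cite: DwivediPagoSeppelt2026, Def. 3.2] -/
def HomIndist (n k : ℕ) (A B : Fin n × Fin n → ℂ) : Prop :=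
  ∀ (a b : ℕ) (E : Multiset (Fin a × Fin b)),
    Literature.Combinatorics.SimpleGraph.treewidth (patternGraph E) < k →
    MvPolynomial.eval A (homPoly E n ℂ) = MvPolynomial.eval B (homPoly E n ℂ)

/-- `f` is POLYLOG-HOM-DETERMINED: for one exponent `c` and every `n`, the value of `f n` at a point of
`ℂ^{n×n}` is determined by the values of the homomorphism polynomials of patterns of treewidth
`< (log₂ n + c)^c` — counting width `≤ polylog` on EDGE-WEIGHTED graphs in the sense of
Dawar–Pago–Seppelt 2025 Def 6.1 (second item). [cite: DawarPagoSeppelt2025, Def. 6.1, Thm. 6.3] -/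
def PolylogHomDetermined (f : (n : ℕ) → MvPolynomial (Fin n × Fin n) ℂ) : Prop :=
  ∃ c : ℕ, ∀ (n : ℕ) (A B : Fin n × Fin n → ℂ),
    HomIndist n ((Nat.log 2 n + c) ^ c) A B →
    MvPolynomial.eval A (f n) = MvPolynomial.eval B (f n)

/-- The conclusion of `OrbitRestorationQP` for one family: square-symmetric circuits of
quasi-polynomial ORBIT size. [cite: DawarWilsenach2025, §3.3] -/
def QPOrbitSymm (f : (n : ℕ) → MvPolynomial (Fin n × Fin n) ℂ) : Prop :=
  ∃ c : ℕ, ∀ n : ℕ, ∃ (G : Type) (_ : Fintype G)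
    (C : LabelledArithCircuit ℂ (Fin n × Fin n) Unit G),
    C.IsSymmetric (Equiv.Perm (Fin n)) ∧ C.eval (C.output ()) = f n ∧
      C.orbitSize (Equiv.Perm (Fin n)) ≤ 2 ^ ((Nat.log 2 n + c) ^ c)

/-- **The graded family `WidthRung d`** (degree budget `d : ℕ → ℕ`): every matrix-symmetric `VP`
family of total degree `≤ d n` that is polylog-hom-determined has square-symmetric circuits of
quasi-polynomial orbit size.  Antitone in `d` (`widthRung_mono`); `d = polylog` is the proved floor,
`d` linear the rung, `d` unrestricted = `WidthRestorationQP`. [new] -/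
def WidthRung (d : ℕ → ℕ) : Prop :=
  ∀ f : (n : ℕ) → MvPolynomial (Fin n × Fin n) ℂ,
    IsMatrixSymmetric f → IsVPFamily f → (∀ n, (f n).totalDegree ≤ d n) →
    PolylogHomDetermined f → QPOrbitSymm f

/-! ### Proved: the family is graded -/

/-- `WidthRung` is antitone in the degree budget. [folklore] -/
theorem widthRung_mono {d d' : ℕ → ℕ} (h : ∀ n, d n ≤ d' n) (hR : WidthRung d') : WidthRung d :=
  fun f hs hVP hd hdet => hR f hs hVP (fun n => (hd n).trans (h n)) hdet

/-- The top of the graded family (`WidthRestorationQP` of the skeleton, unfolded: width-to-orbit restoration for ALL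
matrix-symmetric `VP` families) gives every rung. [folklore] -/
theorem widthRung_of_top
    (h : ∀ f : (n : ℕ) → MvPolynomial (Fin n × Fin n) ℂ,
      IsMatrixSymmetric f → IsVPFamily f → PolylogHomDetermined f → QPOrbitSymm f) (d : ℕ → ℕ) :
    WidthRung d :=
  fun f hs hVP _ hdet => h f hs hVP hdet

end Summit.ValiantsHypothesis.ValiantsHypothesis.Theorems.MonotoneRestorationQPLinearWidth

end
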